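import Summits.Ventures.YMGap.Conjectures.StrongCouplingChiralLROSchwingerDysonSetup
import Literature.MathematicalPhysics.QuantumLattice.StaggeredGaugeGaussianCorrectedReflectionPositivity
import Literature.MathematicalPhysics.StatisticalMechanics.ComplexSpinRPWeightInfraredBound
import HarnessLib
import HarnessLib.Audit.Tags

/-!
# Row S3 of Y3 beyond `β = 0` (1/4): the `β`-dressed meson weight of the massless `U(N)` theory as a
# complex spin system with a general (non-product) weight

Cell `pub-ymgap`, seat qcd-lit g21 (literature-prover), `bears_on: Q1` (typed node
`SalmhoferSeilerSmallBeta`, census row S3: the infrared bound (IR)_{β,4N} at `β > 0`, uniformly in the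
volume — NOT in print).  Everything is a theorem (0 facts, 0 sorry).

THE DICTIONARY (every `N`, every real `β`).  Integrating out the gauge field at coupling `β` turns the
massless staggered `U(N)` theory on the even torus into a "complex spin system" in Salmhofer–Seiler's
sense (Remark 3.2) with a weight that is no longer of nearest-neighbour product form: with
`σ_x ↦ σ̂_x = ψ̄ψ(x)/2N` (`bos`, the tree's `mesonPoly`) and the meson moments
`w_β(m) = s·J_β(∏_x σ̂_x^{m_x})` (`mesonMoment`; `J_β`, `s` the un-normalised periodic functional and the
chiral sign of `…SchwingerDysonSetup`), the polynomial `W_β = ∑_{m + m' = (N,…,N)} w_β(m) σ^{m'}`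
(`mesonWeightC`) satisfies **`[P · W_β]_{(N,…,N)} = s·J_β(P(σ̂))` for every polynomial `P`**
(`bracketW_mesonWeightC`): the coefficient-extraction bracket of the tree's general-weight
Gaussian-domination files (`ComplexSpinRPWeightGaussianDomination`, `…InfraredBound`) IS the coupled
expectation.  The moments are the nonnegative reals `S_β(∏σ̂^m)` (chiral positivity,
`mesonMoment_eq_sdS`), so `W_β` is the complexification of a real weight `mesonWeight β`;
`[1]_{W_β} = S_β(1) > 0`, `[σ_xσ_y]_{W_β} = S_β(σ̂_xσ̂_y)`, and the conjecture's kernel is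
`ssTwoPoint N ν L β 0 x y = (2N)² [σ_xσ_y]_{W_β} / [1]_{W_β}` (`ssTwoPoint_eq_twoPtWR_div`).

Companions: `…MesonWeightBackground` (the background weight `W_β·∏e_D^{-σσ'}` and the congruence of
`…InfraredBound`, `N = 1`), `…MesonWeightTimePlane` (its reflection positivity for the time plane at
every `β ≥ 0`), `…MesonWeightInfraredBound` (the infrared bound and the `N = 1` conjunct of Y3 under
lattice symmetry).  Honest framing: finite even torus, every real `β`; nothing about the continuum or the
summit's `QCD` conjunct.

## References
* [SalmhoferSeiler1991] M. Salmhofer, E. Seiler, Commun. Math. Phys. 139 (1991) 395–432, §2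
  (2.9)–(2.14), (2.20)–(2.21), Remark 3.2, (3.100).
* [MontvayMunster1994] I. Montvay, G. Münster, *Quantum Fields on a Lattice*, CUP 1994, §5.1.6.
-/

noncomputable section

open MeasureTheory Finset MvPolynomial
open scoped ComplexConjugate BigOperators ComplexOrder
open Literature.MathematicalPhysics.QuantumFieldTheory (Site Edge GaugeConfig Site.timeReflect)
open Literature.MathematicalPhysics.QuantumFieldTheory.WilsonRP
open Literature.MathematicalPhysics.QuantumLattice
open Literature.MathematicalPhysics.QuantumLattice.GrassmannAlgebra
open Literature.MathematicalPhysics.QuantumLattice.StrongCoupling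
open Literature.MathematicalPhysics.QuantumLattice.StaggeredRP (definingRep thetaT posAlg posSites IsPosSite
  gaussCorr)
open Literature.MathematicalPhysics.StatisticalMechanics
open Literature.MathematicalPhysics.StatisticalMechanics.ComplexSpin
open Literature.Barriers.CriticalPhenomena.NonGibbs
open Literature.Probability.LatticeModels (TorusSite)

namespace Summit.Ventures.YMGap.Conjectures

namespace MesonWeight

open SchwingerDyson

variable {N ν L : ℕ} [NeZero L] [LinearOrder (TorusSite ν L)]


/-! ### The bosonisation map and the meson moments -/

variable (N) in
/-- Salmhofer–Seiler's spin normalisation `σ_x = ψ̄ψ(x)/(2N)` ((2.20)–(2.21)): the constant `1/(2N)`. [cite: SalmhoferSeiler1991, §2 (2.20)–(2.21)] -/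
def spinScale : ℝ := 1 / (2 * N)

variable (N) in
/-- **The bosonisation map** `P ↦ P(σ̂)`, `σ̂_x = ψ̄ψ(x)/(2N)`, into the fermion algebra (the tree's
`mesonPoly`, values in the centre). [cite: SalmhoferSeiler1991, §2 (2.20)–(2.21)] -/
def bos (P : MvPolynomial (TorusSite ν L) ℂ) : FermiAlg (TorusSite ν L) N :=
  ((mesonPoly N ((spinScale N : ℝ) : ℂ) P : Subalgebra.center ℂ (FermiAlg (TorusSite ν L) N)) :
    FermiAlg (TorusSite ν L) N)

omit [NeZero L] in
/-- `bos` is additive. [cite: SalmhoferSeiler1991, §2 (2.20)] -/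
theorem bos_add (P Q : MvPolynomial (TorusSite ν L) ℂ) : bos N (P + Q) = bos N P + bos N Q := by
  rw [bos, map_add]; rfl

omit [NeZero L] in
/-- `bos` is multiplicative. [cite: SalmhoferSeiler1991, §2 (2.20)] -/
theorem bos_mul (P Q : MvPolynomial (TorusSite ν L) ℂ) : bos N (P * Q) = bos N P * bos N Q := by
  rw [bos, map_mul]; rfl

omit [NeZero L] in
/-- `bos` is `ℂ`-linear. [cite: SalmhoferSeiler1991, §2 (2.20)] -/
theorem bos_smul (a : ℂ) (P : MvPolynomial (TorusSite ν L) ℂ) : bos N (a • P) = a • bos N P := by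
  rw [bos, map_smul]; rfl

omit [NeZero L] in
/-- `bos (C a) = a`. [cite: SalmhoferSeiler1991, §2 (2.20)] -/
theorem bos_C (a : ℂ) : bos N (C a : MvPolynomial (TorusSite ν L) ℂ) = algebraMap ℂ _ a := by
  rw [bos, ← MvPolynomial.algebraMap_eq, AlgHom.commutes]; rfl

omit [NeZero L] in
/-- `bos 1 = 1`. [cite: SalmhoferSeiler1991, §2 (2.20)] -/
theorem bos_one : bos N (1 : MvPolynomial (TorusSite ν L) ℂ) = 1 := by
  rw [bos, map_one]; rfl

omit [NeZero L] in
/-- `bos σ_x = σ̂_x = (2N)⁻¹ ψ̄ψ(x)`. [cite: SalmhoferSeiler1991, §2 (2.20)–(2.21)] -/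
theorem bos_X (x : TorusSite ν L) :
    bos N (X x : MvPolynomial (TorusSite ν L) ℂ) = ((spinScale N : ℝ) : ℂ) • meson x := by
  rw [bos, coe_mesonPoly_X]

omit [NeZero L] in
/-- `bos (∑ P_a) = ∑ bos P_a`. [cite: SalmhoferSeiler1991, §2 (2.20)] -/
theorem bos_sum {α : Type*} (s : Finset α) (P : α → MvPolynomial (TorusSite ν L) ℂ) :
    bos N (∑ a ∈ s, P a) = ∑ a ∈ s, bos N (P a) := by
  rw [bos, map_sum, AddSubmonoidClass.coe_finsetSum]; rfl

omit [NeZero L] in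
/-- `bos` values commute with everything (they lie in the centre). [cite: SalmhoferSeiler1991, §2 (2.20)] -/
theorem commute_bos (P : MvPolynomial (TorusSite ν L) ℂ) (z : FermiAlg (TorusSite ν L) N) : Commute (bos N P) z :=
  (Subalgebra.mem_center_iff.1 (mesonPoly N ((spinScale N : ℝ) : ℂ) P).2 z).symm

/-- `bos (a σ^m) = a ∏_x σ̂_x^{m_x}` (product in the centre). [cite: SalmhoferSeiler1991, §2 (2.20)] -/
theorem bos_monomial (m : TorusSite ν L →₀ ℕ) (a : ℂ) :
    bos N (monomial m a) =
      a • ((∏ x, mesonC ((spinScale N : ℝ) : ℂ) x ^ m x : Subalgebra.center ℂ (FermiAlg (TorusSite ν L) N)) :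
        FermiAlg (TorusSite ν L) N) := by
  rw [bos, coe_mesonPoly_monomial]

/-- Monomials with an exponent `> N` bosonise to `0` (`(ψ̄ψ)^{N+1} = 0`). [cite: SalmhoferSeiler1991, §2 (2.20)] -/
theorem bos_monomial_eq_zero {m : TorusSite ν L →₀ ℕ} (hm : ¬ m ≤ topExponent N) (a : ℂ) :
    bos N (monomial m a) = 0 := by
  rw [Finsupp.le_def] at hm
  push Not at hm
  obtain ⟨x, hx⟩ := hm
  rw [topExponent_apply'] at hx
  have h0 : (mesonC ((spinScale N : ℝ) : ℂ) x ^ m x : Subalgebra.center ℂ (FermiAlg (TorusSite ν L) N)) = 0 := by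
    apply Subtype.ext
    rw [SubmonoidClass.coe_pow, coe_mesonC, smul_pow, meson_pow_eq_zero x hx, smul_zero]; rfl
  rw [bos_monomial, Finset.prod_eq_zero (Finset.mem_univ x) h0]
  simp

/-- Bosonised monomials are chirally positive (`σ̂_x = (2N)⁻¹∑_a ψ̄_aψ_a(x)` with `(2N)⁻¹ ≥ 0`). [cite: MontvayMunster1994, §5.1.6 (5.120)–(5.121)] -/
theorem isChiralPositive_bos_monomial (m : TorusSite ν L →₀ ℕ) :
    IsChiralPositive (evens ν L) (bos N (monomial m 1)) := by
  classical
  have hc : 0 ≤ spinScale N := by unfold spinScale; positivity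
  have key : ∀ s : Finset (TorusSite ν L), IsChiralPositive (evens ν L)
      (((∏ x ∈ s, mesonC ((spinScale N : ℝ) : ℂ) x ^ m x : Subalgebra.center ℂ (FermiAlg (TorusSite ν L) N)) :
        FermiAlg (TorusSite ν L) N)) := by
    intro s
    induction s using Finset.induction_on with
    | empty => rw [Finset.prod_empty, Subalgebra.coe_one]; exact IsChiralPositive.one
    | insert x s hx ih =>
      rw [Finset.prod_insert hx, Subalgebra.coe_mul, SubmonoidClass.coe_pow, coe_mesonC]
      exact ((IsChiralPositive.smul (isChiralPositive_meson (evens ν L) x) hc).pow _).mul ih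
  rw [bos_monomial, one_smul]
  exact key Finset.univ

/-! ### The un-normalised functional `J_β` is linear -/

/-- The integrand of `J_β(G)` is integrable. [cite: SalmhoferSeiler1991, §2 (2.12)] -/
theorem integrable_sdJ (hL : Even L) (β : ℝ) (G : FermiAlg (TorusSite ν L) N) :
    Integrable (fun U : GaugeConfig ν L (UN N) => (plaq N ν L β U : ℂ) * berezin ℂ _ (G * fermiW U)) (haarPi N ν L) :=
  integrable_of_continuous ((Complex.continuous_ofReal.comp (continuous_plaq β)).mul
    (continuous_apply_of_coeffContinuous ((CoeffContinuous.const G).mul (coeffContinuous_fermiW hL)) _))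

/-- `J_β` is additive. [cite: SalmhoferSeiler1991, §2 (2.9)–(2.10)] -/
theorem sdJ_add (hL : Even L) (β : ℝ) (G G' : FermiAlg (TorusSite ν L) N) :
    sdJ N ν L β (G + G') = sdJ N ν L β G + sdJ N ν L β G' := by
  rw [sdJ, sdJ, sdJ, ← integral_add (integrable_sdJ hL β G) (integrable_sdJ hL β G')]
  refine integral_congr_ae (ae_of_all _ fun U => ?_)
  simp only [add_mul, map_add, mul_add]

/-- `J_β` is homogeneous. [cite: SalmhoferSeiler1991, §2 (2.9)–(2.10)] -/
theorem sdJ_smul (β : ℝ) (a : ℂ) (G : FermiAlg (TorusSite ν L) N) :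
    sdJ N ν L β (a • G) = a * sdJ N ν L β G := by
  rw [sdJ, sdJ, ← integral_const_mul]
  refine integral_congr_ae (ae_of_all _ fun U => ?_)
  simp only [smul_mul_assoc, map_smul, smul_eq_mul]
  ring

/-- `J_β(0) = 0`. [cite: SalmhoferSeiler1991, §2 (2.9)–(2.10)] -/
theorem sdJ_zero (β : ℝ) : sdJ N ν L β (0 : FermiAlg (TorusSite ν L) N) = 0 := by
  simp [sdJ]

/-- `J_β(∑ G_a) = ∑ J_β(G_a)`. [cite: SalmhoferSeiler1991, §2 (2.9)–(2.10)] -/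
theorem sdJ_sum (hL : Even L) (β : ℝ) {α : Type*} (s : Finset α) (G : α → FermiAlg (TorusSite ν L) N) :
    sdJ N ν L β (∑ a ∈ s, G a) = ∑ a ∈ s, sdJ N ν L β (G a) := by
  classical
  induction s using Finset.induction_on with
  | empty => simp [sdJ_zero]
  | insert a s ha ih => rw [Finset.sum_insert ha, Finset.sum_insert ha, sdJ_add hL, ih]

/-! ### The meson moments and the `β`-dressed meson weight -/

variable (N ν L) in
/-- **The meson moments** `w_β(m) = s · J_β(∏_x σ̂_x^{m_x})` of the massless `U(N)` theory at coupling `β`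
(`s` the chiral sign, `J_β` the periodic un-normalised functional). [cite: SalmhoferSeiler1991, §2 (2.9)–(2.10), (2.20)] -/
def mesonMoment (β : ℝ) (m : TorusSite ν L →₀ ℕ) : ℂ :=
  chiralSign (N := N) (evens ν L) * sdJ N ν L β (bos N (monomial m 1))

/-- Moments with an exponent `> N` vanish. [cite: SalmhoferSeiler1991, §2 (2.20)] -/
theorem mesonMoment_eq_zero_of_not_le (β : ℝ) {m : TorusSite ν L →₀ ℕ} (hm : ¬ m ≤ topExponent N) :
    mesonMoment N ν L β m = 0 := by
  rw [mesonMoment, bos_monomial_eq_zero hm, sdJ_zero, mul_zero]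

/-- **The moments are the nonnegative numbers `S_β(∏σ̂^{m})`** (chiral positivity). [cite: MontvayMunster1994, §5.1.6 (5.120)–(5.121)] -/
theorem mesonMoment_eq_sdS (hL : Even L) (β : ℝ) (m : TorusSite ν L →₀ ℕ) :
    mesonMoment N ν L β m = ((sdS N ν L β (bos N (monomial m 1)) : ℝ) : ℂ) := by
  rw [mesonMoment, chiralSign_mul_sdJ hL β (isChiralPositive_bos_monomial m)]

variable (N ν L) in
/-- **The `β`-dressed meson weight** `W_β = ∑_{m + m' = (N,…,N)} w_β(m) σ^{m'}` — the complex spin weight whose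
coefficient-extraction bracket is the coupled expectation (`bracketW_mesonWeightC`). [cite: SalmhoferSeiler1991, Remark 3.2 and §2 (2.20)] -/
def mesonWeightC (β : ℝ) : FieldAlg ν L :=
  ∑ p ∈ Finset.HasAntidiagonal.antidiagonal (topExponent (ν := ν) (L := L) N), monomial p.2 (mesonMoment N ν L β p.1)

/-- The bracket of a monomial: `[a σ^m]_{W_β} = a · w_β(m)`. [cite: SalmhoferSeiler1991, Remark 3.2] -/
theorem bracketW_mesonWeightC_monomial (β : ℝ) (m : TorusSite ν L →₀ ℕ) (a : ℂ) :
    bracketW N (mesonWeightC N ν L β) (monomial m a) = a * mesonMoment N ν L β m := by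
  classical
  rw [bracketW, mesonWeightC, Finset.mul_sum, coeff_sum]
  simp only [monomial_mul, coeff_monomial]
  have hiff : ∀ p ∈ Finset.HasAntidiagonal.antidiagonal (topExponent (ν := ν) (L := L) N),
      (m + p.2 = topExponent N ↔ p.1 = m) := by
    intro p hp
    rw [Finset.HasAntidiagonal.mem_antidiagonal] at hp
    constructor
    · intro h; exact add_right_cancel (hp.trans h.symm)
    · intro h; rw [← h]; exact hp
  rw [Finset.sum_congr rfl fun p hp => by rw [if_congr (hiff p hp) rfl rfl]]
  by_cases hle : m ≤ topExponent N
  · rw [Finset.sum_eq_single_of_mem (m, topExponent N - m)]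
    · rw [if_pos rfl]
    · rw [Finset.HasAntidiagonal.mem_antidiagonal]; exact add_tsub_cancel_of_le hle
    · intro p hp hpm
      rw [if_neg]
      intro h
      apply hpm
      rw [Finset.HasAntidiagonal.mem_antidiagonal] at hp
      have h2 : p.2 = topExponent N - m := by
        rw [← h]; exact eq_tsub_of_add_eq (by rw [add_comm]; exact hp)
      exact Prod.ext h h2
  · rw [Finset.sum_eq_zero, mesonMoment_eq_zero_of_not_le β hle, mul_zero]
    intro p hp
    rw [if_neg]
    intro h
    apply hle
    rw [Finset.HasAntidiagonal.mem_antidiagonal] at hp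
    rw [← h, ← hp]
    exact le_self_add

/-- **THE DICTIONARY**: `[P · W_β]_{(N,…,N)} = s · J_β(P(σ̂))` for every polynomial `P` — the
coefficient-extraction bracket of the weight `W_β` is the (un-normalised, sign-corrected) coupled
expectation of the bosonised observable. [cite: SalmhoferSeiler1991, Remark 3.2 and §2 (2.20)–(2.21)] -/
theorem bracketW_mesonWeightC (hL : Even L) (β : ℝ) (P : FieldAlg ν L) :
    bracketW N (mesonWeightC N ν L β) P = chiralSign (N := N) (evens ν L) * sdJ N ν L β (bos N P) := by
  conv_lhs => rw [P.as_sum, bracketW_sum]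
  conv_rhs => rw [P.as_sum, bos_sum, sdJ_sum hL, Finset.mul_sum]
  refine Finset.sum_congr rfl fun m _ => ?_
  rw [bracketW_mesonWeightC_monomial, mesonMoment, show monomial m (coeff m P) = coeff m P • monomial m (1 : ℂ) by
    rw [smul_monomial, smul_eq_mul, mul_one], bos_smul, sdJ_smul]
  ring

/-! ### The real weight -/

variable (N ν L) in
/-- The real meson moments `S_β(∏σ̂^m) ≥ 0`. [cite: MontvayMunster1994, §5.1.6 (5.120)–(5.121)] -/
def mesonMomentR (β : ℝ) (m : TorusSite ν L →₀ ℕ) : ℝ := sdS N ν L β (bos N (monomial m 1))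

/-- The real moments are nonnegative. [cite: MontvayMunster1994, §5.1.6 (5.120)–(5.121)] -/
theorem mesonMomentR_nonneg (hL : Even L) (β : ℝ) (m : TorusSite ν L →₀ ℕ) : 0 ≤ mesonMomentR N ν L β m :=
  sdS_nonneg hL β (isChiralPositive_bos_monomial m)

variable (N ν L) in
/-- **The real `β`-dressed meson weight** `W_β ∈ ℝ[σ]` (nonnegative coefficients). [cite: SalmhoferSeiler1991, Remark 3.2 and §2 (2.20)] -/
def mesonWeight (β : ℝ) : MvPolynomial (TorusSite ν L) ℝ :=
  ∑ p ∈ Finset.HasAntidiagonal.antidiagonal (topExponent (ν := ν) (L := L) N), monomial p.2 (mesonMomentR N ν L β p.1)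

/-- Its complexification is `W_β`. [cite: SalmhoferSeiler1991, Remark 3.2] -/
theorem map_mesonWeight (hL : Even L) (β : ℝ) :
    MvPolynomial.map Complex.ofRealHom (mesonWeight N ν L β) = mesonWeightC N ν L β := by
  rw [mesonWeight, mesonWeightC, map_sum]
  refine Finset.sum_congr rfl fun p _ => ?_
  rw [map_monomial, mesonMoment_eq_sdS hL]
  rfl

/-- **The real bracket of `W_β` is the coupled expectation**: `[P]_{W_β} = s·J_β(P(σ̂))` for real `P`. [cite: SalmhoferSeiler1991, Remark 3.2 and §2 (2.20)–(2.21)] -/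
theorem bracketWR_mesonWeight (hL : Even L) (β : ℝ) (P : MvPolynomial (TorusSite ν L) ℝ) :
    ((bracketWR N (mesonWeight N ν L β) P : ℝ) : ℂ) =
      chiralSign (N := N) (evens ν L) * sdJ N ν L β (bos N (MvPolynomial.map Complex.ofRealHom P)) := by
  rw [← bracketW_map_map, map_mesonWeight hL, bracketW_mesonWeightC hL]

/-- `[1]_{W_β} = S_β(1)` (`> 0`). [cite: SalmhoferSeiler1991, §2 (2.9)] -/
theorem bracketWR_mesonWeight_one (hL : Even L) (β : ℝ) : bracketWR N (mesonWeight N ν L β) 1 = sdS N ν L β 1 := by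
  apply Complex.ofReal_injective
  rw [bracketWR_mesonWeight hL, map_one, bos_one, chiralSign_mul_sdJ hL β IsChiralPositive.one]

/-- `[1]_{W_β} > 0` (`ν ≥ 1`). [cite: SalmhoferSeiler1991, §2 (2.11)] -/
theorem bracketWR_mesonWeight_one_pos [NeZero ν] (hL : Even L) (β : ℝ) : 0 < bracketWR N (mesonWeight N ν L β) 1 := by
  rw [bracketWR_mesonWeight_one hL]; exact sdS_one_pos hL β

omit [NeZero L] in
/-- `bos (σ_x σ_y) = σ̂_xσ̂_y` is the tree's `spinPair`. [cite: SalmhoferSeiler1991, §2 (2.20)–(2.21)] -/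
theorem bos_X_mul_X (hN : N ≠ 0) (x y : TorusSite ν L) :
    bos N (X x * X y : MvPolynomial (TorusSite ν L) ℂ) = spinPair x y := by
  rw [bos_mul, bos_X, bos_X, spinPair, smul_mul_smul_comm]
  congr 1
  have hN' : (N : ℂ) ≠ 0 := Nat.cast_ne_zero.2 hN
  unfold spinScale
  push_cast
  field_simp
  ring

/-- **The two-point kernel of `W_β`**: `[σ_xσ_y]_{W_β} = S_β(σ̂_xσ̂_y)`. [cite: SalmhoferSeiler1991, (3.100) and §2 (2.14)] -/
theorem twoPtWR_mesonWeight (hL : Even L) (hN : N ≠ 0) (β : ℝ) (x y : TorusSite ν L) :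
    twoPtWR N (mesonWeight N ν L β) x y = sdS N ν L β (spinPair x y) := by
  apply Complex.ofReal_injective
  rw [twoPtWR, bracketWR_mesonWeight hL, map_mul, map_X, map_X, bos_X_mul_X hN, chiralSign_mul_sdJ hL β]
  rw [spinPair, show ((1 : ℂ) / (4 * (N : ℂ) ^ 2)) = (((1 / (4 * (N : ℝ) ^ 2) : ℝ)) : ℂ) by push_cast; ring]
  exact ((isChiralPositive_meson _ x).mul (isChiralPositive_meson _ y)).smul (by positivity)

/-- **The conjecture's kernel through the weight**: `ssTwoPoint N ν L β 0 x y = (2N)² [σ_xσ_y]_{W_β} / [1]_{W_β}`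
(every real `β`, even `L`, `ν ≥ 1`). [cite: SalmhoferSeiler1991, §2 (2.14), (2.20)–(2.21)] -/
theorem ssTwoPoint_eq_twoPtWR_div [NeZero ν] (hN : N ≠ 0) (hL : Even L) (β : ℝ) (x y : TorusSite ν L) :
    ssTwoPoint N ν L β 0 x y =
      (2 * N : ℝ) ^ 2 * twoPtWR N (mesonWeight N ν L β) x y / bracketWR N (mesonWeight N ν L β) 1 := by
  rw [ssTwoPoint_eq_spinPair hN hL, twoPtWR_mesonWeight hL hN, bracketWR_mesonWeight_one hL]

end MesonWeight

end Summit.Ventures.YMGap.Conjectures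

end
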